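/-
Copyright (c) 2026 the pub-hodgecm-mathlib formalisation cell (harness21).  Prover seat hodgecm-mathlib-K2Liu-p09 (g0): Track B «K2-LIT»,
#184♮ = hLiu418 = stmt-HodgeConjecture-24832, file #9 of the K2_Liu road, organ (III-b) step E5′a (bridge `blk` ↔ `U(σ, T ⊕ −T)`); 2026-09-03.
-/
import Literature.NumberTheory.GelbartRogawski1991.DoubledUnitarySiegelParabolicAlgebra   -- ★ `blk`, `blk_mul`, `HA`
import Summits.HodgeConjecture.HodgeConjecture.Theorems.K2LiuSiegelDoubledIwasawaCompact  -- ★ `reindex_symm_mul_mul`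
import HarnessLib

/-!
# Crux `HLiu418`, Track B road `K2_Liu`, unit U3a «SIEGEL EISENSTEIN SERIES», file #9 — helper 11 (organ (III-b), step E5′a, BRIDGE):
# membership in `H(𝔸) = U(𝕍 ⊕ −𝕍)(𝔸)` read on the block matrix `blk h`, and elements of `H(𝔸)` with PRESCRIBED blocks

Cell `hodgecm-mathlib`, crux item hLiu418 = `stmt-HodgeConjecture-24832`; squad K2 ∕ K2Liu, prover K2Liu-p09 (g0).  THEOREMS ONLY; lane
`--supports stmt-HodgeConjecture-24832` (count-neutral helper; the bridge between the ring-level Siegel∕Levi algebra — ★ GR91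
`AdaptedBlocks`, ★ `K2LiuSiegelDoubledLeviAlgebra` — and the group `H(𝔸)` of ★ `GRConstruction`, for the letters `leviPart ∕ siegelLevi ∕
siegelUnipotent` of step E5′a of PLAN-G2 v2 toward socket #15b ∕ #9).

With `T_𝔸 := gramR ⊗ 1 ∈ M_n(𝔸_L)` (the real Gram matrix of `𝕎 = Res(V ⊗ W)` read in `𝔸_L`) and `σ = c ⊗ 1`:
* `adelicForm_hermD_eq_reindex` — the adelic form of the doubled datum IS `reindex e₂ e₂ (T_𝔸 ⊕ −T_𝔸)`;
* **`cstar_blk`** — for `h ∈ H(𝔸)`: `σ(blk h)ᵀ (T_𝔸 ⊕ −T_𝔸) (blk h) = T_𝔸 ⊕ −T_𝔸` (the unitarity in `e₂`-blocks);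
* **`exists_mem_HA_of_cstar`** — conversely, an invertible block matrix `X` (with a two-sided inverse `Y`) satisfying the block unitarity is `blk q`
  for a (unique) `q ∈ H(𝔸)`; `blk_injective`.

HONEST LABEL.  Count-neutral helper of the K2_Liu road; it retires nothing by itself: `HC_CM` is proved only modulo the 7 printed
citations (2 remaining named inputs: hLiu418 = `stmt-HodgeConjecture-24832`, h413 = `stmt-HodgeConjecture-24833`) until rung 0 closes.

## References
* [GelbartRogawski1991] S. Gelbart, J. Rogawski, Invent. Math. 105 (1991), §3.1 (the doubled group of the datum).
* [HarrisKudlaSweet1996] M. Harris, S. S. Kudla, W. J. Sweet, J. Amer. Math. Soc. 9 (1996), §1 (1.11).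
* [Garrett2018] P. Garrett, *Modern Analysis of Automorphic Forms by Example* (2018), §3.10.
-/

set_option autoImplicit false
-- the mandated namespace repeats the single-problem summit's segment (`HodgeConjecture.HodgeConjecture`)
set_option linter.dupNamespace false

noncomputable section

open scoped Matrix
open NumberField IsDedekindDomain

namespace Summit.HodgeConjecture.HodgeConjecture.Cruxes.HLiu418.K2LiuSiegelDoubledBlkUnitary

open Literature.NumberTheory.Automorphic Literature.NumberTheory.Automorphic.UnitaryGroup
open Literature.NumberTheory.GelbartRogawski1991 Literature.NumberTheory.GelbartRogawski1991.GRConstruction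
open UnitaryDualPair
open Summit.HodgeConjecture.HodgeConjecture.Cruxes.HLiu418.K2LiuSiegelDoubledIwasawaCompact

variable (L : Type) [Field L] [NumberField L] [IsCMField L]
variable {N M n : ℕ} (e : Fin N × Fin M ≃ Fin n)
  (dV : Fin N → L) (hdV : ∀ i, IsCMField.complexConj L (dV i) = dV i)
  (dW : Fin M → L) (hdW : ∀ i, IsCMField.complexConj L (dW i) = dW i)

/-- **The adelic form of the doubled datum in blocks**: `adelicForm hermD = reindex e₂ e₂ (T_𝔸 ⊕ −T_𝔸)` with
`T_𝔸 = gramR.map (L⁺ → L → 𝔸_L)`. [cite: GelbartRogawski1991, §3.1 Prop. 3.1.1 p. 455 L1–2] -/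
theorem adelicForm_hermD_eq_reindex :
    adelicForm L (n + n) (hermD L e dV hdV dW hdW) =
      Matrix.reindex (e₂ (n := n)) (e₂ (n := n)) (Matrix.fromBlocks
        ((gramR L e dV hdV dW hdW).map ((algebraMap L (AdeleRing (𝓞 L) L)).comp (algebraMap (Fp L) L))) 0 0
        (-(gramR L e dV hdV dW hdW).map ((algebraMap L (AdeleRing (𝓞 L) L)).comp (algebraMap (Fp L) L)))) := by
  set f : Fp L →+* AdeleRing (𝓞 L) L := (algebraMap L (AdeleRing (𝓞 L) L)).comp (algebraMap (Fp L) L) with hf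
  rw [adelicForm, hermD, gramD, Matrix.map_map, ← RingHom.coe_comp, ← hf, Matrix.reindex_apply, Matrix.reindex_apply,
    ← Matrix.submatrix_map, Matrix.fromBlocks_map, Matrix.map_zero f (map_zero f), Matrix.map_neg _ (map_neg f)]

section Reindex
variable {R : Type*}

/-- `reindex e₂⁻¹ e₂⁻¹ ∘ reindex e₂ e₂ = id`. [folklore] -/
theorem reindex_symm_reindex (A : Matrix (Fin n ⊕ Fin n) (Fin n ⊕ Fin n) R) :
    Matrix.reindex (e₂ (n := n)).symm (e₂ (n := n)).symm (Matrix.reindex (e₂ (n := n)) (e₂ (n := n)) A) = A := by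
  rw [← Matrix.reindex_symm, Equiv.symm_apply_apply]

/-- `reindex e₂ e₂ ∘ reindex e₂⁻¹ e₂⁻¹ = id`. [folklore] -/
theorem reindex_reindex_symm (A : Matrix (Fin (n + n)) (Fin (n + n)) R) :
    Matrix.reindex (e₂ (n := n)) (e₂ (n := n)) (Matrix.reindex (e₂ (n := n)).symm (e₂ (n := n)).symm A) = A := by
  rw [← Matrix.reindex_symm, Equiv.apply_symm_apply]

variable [CommRing R]

/-- `reindex` along `e₂` is multiplicative (three factors). [folklore] -/
theorem reindex_mul_mul (A B C : Matrix (Fin n ⊕ Fin n) (Fin n ⊕ Fin n) R) :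
    Matrix.reindex (e₂ (n := n)) (e₂ (n := n)) (A * B * C) =
      Matrix.reindex (e₂ (n := n)) (e₂ (n := n)) A * Matrix.reindex (e₂ (n := n)) (e₂ (n := n)) B *
        Matrix.reindex (e₂ (n := n)) (e₂ (n := n)) C := by
  simp only [Matrix.reindex_apply, Matrix.submatrix_mul_equiv]

/-- `reindex` commutes with `σ`-transpose. [folklore] -/
theorem reindex_symm_cstar (A : Matrix (Fin (n + n)) (Fin (n + n)) R) (σ : R →+* R) :
    Matrix.reindex (e₂ (n := n)).symm (e₂ (n := n)).symm ((A.map σ)ᵀ) =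
      ((Matrix.reindex (e₂ (n := n)).symm (e₂ (n := n)).symm A).map σ)ᵀ :=
  Matrix.ext fun _ _ => rfl

/-- `reindex` commutes with `σ`-transpose (other direction). [folklore] -/
theorem reindex_cstar (A : Matrix (Fin n ⊕ Fin n) (Fin n ⊕ Fin n) R) (σ : R →+* R) :
    Matrix.reindex (e₂ (n := n)) (e₂ (n := n)) ((A.map σ)ᵀ) = ((Matrix.reindex (e₂ (n := n)) (e₂ (n := n)) A).map σ)ᵀ :=
  Matrix.ext fun _ _ => rfl

end Reindex

/-- **Unitarity in blocks**: for `h ∈ H(𝔸)`, `σ(blk h)ᵀ · (T_𝔸 ⊕ −T_𝔸) · blk h = T_𝔸 ⊕ −T_𝔸`. [cite: HarrisKudlaSweet1996, §1 (1.11)] -/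
theorem cstar_blk (h : HA L e dV hdV dW hdW) :
    ((blk L e dV hdV dW hdW h).map (conjAdele (Fp L) L (IsCMField.complexConj L)))ᵀ *
        Matrix.fromBlocks ((gramR L e dV hdV dW hdW).map ((algebraMap L (AdeleRing (𝓞 L) L)).comp (algebraMap (Fp L) L))) 0 0
          (-(gramR L e dV hdV dW hdW).map ((algebraMap L (AdeleRing (𝓞 L) L)).comp (algebraMap (Fp L) L))) *
        blk L e dV hdV dW hdW h =
      Matrix.fromBlocks ((gramR L e dV hdV dW hdW).map ((algebraMap L (AdeleRing (𝓞 L) L)).comp (algebraMap (Fp L) L))) 0 0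
        (-(gramR L e dV hdV dW hdW).map ((algebraMap L (AdeleRing (𝓞 L) L)).comp (algebraMap (Fp L) L))) := by
  have hmem := mem_unitaryGroupOfForm_iff.1 h.2
  rw [adelicForm_hermD_eq_reindex L e dV hdV dW hdW] at hmem
  have key := congrArg (Matrix.reindex (e₂ (n := n)).symm (e₂ (n := n)).symm) hmem
  rw [reindex_symm_mul_mul, reindex_symm_reindex, reindex_symm_cstar] at key
  exact key

/-- `blk` is injective. [folklore] -/
theorem blk_injective : Function.Injective (blk L e dV hdV dW hdW) := fun _ _ h =>
  Subtype.ext (Units.ext ((Matrix.reindex (e₂ (n := n)).symm (e₂ (n := n)).symm).injective h))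

/-- **Elements of `H(𝔸)` with PRESCRIBED blocks**: a block matrix `X` with a two-sided inverse `Y` and the block unitarity
`σ(X)ᵀ (T_𝔸 ⊕ −T_𝔸) X = T_𝔸 ⊕ −T_𝔸` is `blk q` for some `q ∈ H(𝔸)`. [cite: HarrisKudlaSweet1996, §1 (1.11)] -/
theorem exists_mem_HA_of_cstar {X Y : Matrix (Fin n ⊕ Fin n) (Fin n ⊕ Fin n) (AdeleRing (𝓞 L) L)} (hXY : X * Y = 1) (hYX : Y * X = 1)
    (hX : (X.map (conjAdele (Fp L) L (IsCMField.complexConj L)))ᵀ *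
        Matrix.fromBlocks ((gramR L e dV hdV dW hdW).map ((algebraMap L (AdeleRing (𝓞 L) L)).comp (algebraMap (Fp L) L))) 0 0
          (-(gramR L e dV hdV dW hdW).map ((algebraMap L (AdeleRing (𝓞 L) L)).comp (algebraMap (Fp L) L))) * X =
      Matrix.fromBlocks ((gramR L e dV hdV dW hdW).map ((algebraMap L (AdeleRing (𝓞 L) L)).comp (algebraMap (Fp L) L))) 0 0
        (-(gramR L e dV hdV dW hdW).map ((algebraMap L (AdeleRing (𝓞 L) L)).comp (algebraMap (Fp L) L)))) :
    ∃ q : HA L e dV hdV dW hdW, blk L e dV hdV dW hdW q = X := by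
  have h1 : Matrix.reindex (e₂ (n := n)) (e₂ (n := n)) X * Matrix.reindex (e₂ (n := n)) (e₂ (n := n)) Y = 1 := by
    rw [← Matrix.mul_one (Matrix.reindex _ _ X * Matrix.reindex _ _ Y),
      show (1 : Matrix (Fin (n + n)) (Fin (n + n)) (AdeleRing (𝓞 L) L)) = Matrix.reindex (e₂ (n := n)) (e₂ (n := n)) 1 from
        by rw [Matrix.reindex_apply, Matrix.submatrix_one_equiv],
      ← reindex_mul_mul, Matrix.mul_one, hXY]
  have h2 : Matrix.reindex (e₂ (n := n)) (e₂ (n := n)) Y * Matrix.reindex (e₂ (n := n)) (e₂ (n := n)) X = 1 := by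
    rw [← Matrix.mul_one (Matrix.reindex _ _ Y * Matrix.reindex _ _ X),
      show (1 : Matrix (Fin (n + n)) (Fin (n + n)) (AdeleRing (𝓞 L) L)) = Matrix.reindex (e₂ (n := n)) (e₂ (n := n)) 1 from
        by rw [Matrix.reindex_apply, Matrix.submatrix_one_equiv],
      ← reindex_mul_mul, Matrix.mul_one, hYX]
  let g : GL (Fin (n + n)) (AdeleRing (𝓞 L) L) :=
    ⟨Matrix.reindex (e₂ (n := n)) (e₂ (n := n)) X, Matrix.reindex (e₂ (n := n)) (e₂ (n := n)) Y, h1, h2⟩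
  have hg : g ∈ HA L e dV hdV dW hdW := by
    show g ∈ unitaryGroupOfForm (conjAdele (Fp L) L (IsCMField.complexConj L)) (adelicForm L (n + n) (hermD L e dV hdV dW hdW))
    rw [mem_unitaryGroupOfForm_iff, adelicForm_hermD_eq_reindex L e dV hdV dW hdW]
    show ((Matrix.reindex (e₂ (n := n)) (e₂ (n := n)) X).map _)ᵀ * _ * Matrix.reindex (e₂ (n := n)) (e₂ (n := n)) X = _
    rw [← reindex_cstar, ← reindex_mul_mul, hX]
  refine ⟨⟨g, hg⟩, ?_⟩
  show Matrix.reindex (e₂ (n := n)).symm (e₂ (n := n)).symm (Matrix.reindex (e₂ (n := n)) (e₂ (n := n)) X) = X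
  exact reindex_symm_reindex X

end Summit.HodgeConjecture.HodgeConjecture.Cruxes.HLiu418.K2LiuSiegelDoubledBlkUnitary

end
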